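import Mathlib
import HarnessLib
import HarnessLib.Audit
import Summits.CriticalPhenomena.Statement
import Literature.Probability.Percolation.CardyFormula
import Literature.Probability.Percolation.Isoradial
import Summits.CriticalPhenomena.CardyFormulaZ2.Theorems.CardyBondTriangularDiscretisationBridge
import HarnessLib.Audit.Status.Attr

/-!
Route: CardyRetileGlue

DORMANT since 2026-08-26T12:04:10Z (reconciler: no traction for 8.3 d (last activity item-evidence-added at 2026-08-18T03:33:38Z); parked, not closed — `ledger route dormant route-CriticalPhenomena-CardyRetileGlue --off` to reactivate) — unstaffed, not closed; items shared with open routes are served there. `ledger route dormant <id> --off` reactivates.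

# Route CardyRetileGlue — retile the observation window exactly, glue canonically — Cardy on Z2 from
Cardy on bond-triangular via a two-model Schramm-Smirnov comparison

It suffices to show X = WindowTransport3 ∧ BondTriangularCardy ∧ DiscretisationBridge (plus the
routine instance fact TriInstance3). WindowTransport3: for every bi-periodic isoradial graph G of
Grimmett–Manolescu's class 𝒢 whose rhombic tiling uses only three edge directions (bond-𝕋,
bond-hexagonal, their periodic grain-boundary mixtures; ℤ² is the two-direction case), the canonical
crossing probability of every conformal rectangle at mesh δ differs from the bond-ℤ² (p = 1/2)
crossing probability of the same rectangle by o(1) as δ → 0⁺ (difference form: no limit is assumed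
to exist). BondTriangularCardy (item shared verbatim with route CardyBondTriangular,
stmt-CriticalPhenomena-4664): canonical bond percolation on 𝕋 satisfies Cardy's formula for every
conformal rectangle. DiscretisationBridge (shared verbatim with routes CardyIsoradial /
CardyBondTriangular, stmt-CriticalPhenomena-0787). Cards realised: canonical-gluing-comparison
(spine: its Gluing Lemma is the analytic crux GluingComparison, here identified with
Schramm–Smirnov's open Question 2 'constructive gluing' in two-model form) and
zero-error-star-triangle-gluing (its exact retiling identity M1 and relocation M2, applied to the
observation window ITSELF so that no un-gluing lemma is needed). The route is the transport half
that route CardyBondTriangular leaves as one XL crux (TriangularToSquareTransport,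
stmt-CriticalPhenomena-4665): the support item TransportSpecialisation derives that crux from
WindowTransport3.
Lean: `WindowTransport3 ∧ BondTriangularCardy ∧ DiscretisationBridge`

## Assembly
Pure logic plus two rewrites (sorry-free in the planner's Sketch.lean, theorems
transportSpecialisation_proof and assembly_proof, rc 0): TriInstance3 supplies (𝕋, emb) in 𝒢 with
three directions and two periods; WindowTransport3 gives P_ℤ² = P_𝕋 − (P_𝕋 − P_ℤ²) with the bracket
→ 0 after rewriting emb.z and the canonical law; BondTriangularCardy gives the Cardy limit for P_𝕋,
hence for the crude ℤ² event (Tendsto.sub, sub_sub_cancel); DiscretisationBridge converts to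
bondDomainCrossingProb, i.e. CardyFormulaZ2. GluingComparison enters through the support glue
TransportOfGluing → WindowTransport3.

Rationale: WHY THIS LINE. Two facts make crossing probabilities transportable EXACTLY between lattices, up to
O(1) seams: (M1) for a lattice polygon P all lozenge (three-direction rhombic) tilings of P give the
SAME law to open crossings of P between boundary arcs, because Thurston flips are star–triangle
moves whose Grimmett–Manolescu coupling preserves every connection among non-centre vertices
(arXiv:1105.5535 Prop. 2.2; in tree, proved:
`Literature.Probability.Percolation.StarTriangle.prodBernoulli_eq_of_isStarTriangleRelated`; flip
connectivity doi:10.2307/2324578); (M2) P admits, besides the tiling induced by the target graph G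
(rhombille = bond-𝕋 / bond-hexagonal), a tiling by O(1) frozen 60°-blocks (refine a coarse tiling),
each block a rotated piece of DKKMO's isoradial rectangular lattice L(π/3), which arXiv:2012.11672
Thm 1.7 + Thm 1.2 couples d_CN-close to isotropic ℤ². The one analytic input is then a COMPARISON
PRINCIPLE: two RSW percolations with α₄ > 1 that agree asymptotically inside the pieces of a finite
smooth seam decomposition agree on every quad — Schramm–Smirnov's factorisation (arXiv:1101.5820 Thm
1.1/1.7, Prop 4.1) read for TWO models, i.e. their Question 2 (constructive gluing, posed open, with
'universality more accessible' as the stated payoff; Khristoforov's 2018 Geneva thesis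
doi:10.13097/archive-ouverte/unige:111513 Ch. II proves lamination gluing only non-constructively).
Imported areas: Tsirelson/Schramm–Smirnov noise factorisation used as a working comparison tool;
isoradial integrability (star–triangle as an identity, never as an estimate); DKKMO's
IIC/track-exchange theorem as a black box. Compared with route CardyIsoradial (r2
CrossingLimitInvariance over all of 𝒢, XL) and route CardyBondTriangular (r4
TriangularToSquareTransport, XL, 'a sweep uses ≍δ⁻² moves') this line never moves a track through
the window: 'retile exactly, then glue' needs DKKMO only for L(α) (where it is a theorem), reaches
every bi-periodic three-direction graph, and hands the anchor to CardyBondTriangular's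
Bollobás–Riordan/Chayes–Lei machinery, so the two routes are the two halves of one proof and share
both end items. Negatives index (one SAW item) untouched.

RANKED CRUXES. #2 GluingComparison (crux) — Comparison principle (card canonical-gluing-comparison,
Gluing Lemma; = Schramm–Smirnov Question 2 in two-model form). Two mesh-indexed families of planar
rhombic-tiling bond percolations (canonical isoradial weights) with uniform box-crossing bounds and
a uniform alternating four-arm bound P[two disjoint open annulus-clusters cross A(w; mδ, nδ)] ≤
(m/n)·Δ(mδ, nδ), Δ(r, ρ) → 0 as r → 0 (SS Assumptions 1.1, four-arm event in the
two-disjoint-clusters form of arXiv:2008.01606), coupled so that for every conformal rectangle whose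
closure avoids a fixed finite union of seam segments the two crossing indicators agree with
probability → 1, have asymptotically equal crossing probabilities for EVERY conformal rectangle (in
particular those straddling the seams). [difficulty: open-problem — = Schramm–Smirnov Question 2,
posed open 2011; refuters g41-20/g41-41/g41-17, grounder g13-40] (why it might fail: SS gluing is
non-constructive (Rem. 3; Question 2 open); Khristoforov 2018 Thm II.3 still picks the gluing map by
variance minimisation under the limit. A mesh- and model-independent rule must show essential
multi-hop / near-miss strip passages are four-arm points ON the seam (SS Conj. 1.2 nearby).)
[arXiv:1101.5820, doi:10.13097/archive-ouverte/unige:111513, arXiv:1008.1378, arXiv:2008.01606,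
arXiv:1204.0505]
#3 WindowTransport3 (crux) — Window transport (cards zero-error-star-triangle-gluing M1–M3 +
canonical-gluing-comparison Use 1, window-retiling form): for every bi-periodic isoradial graph of
the GM class (preconnected, isoradial rhombic tiling, square-grid property, BAP(ε)) whose
rhombus-edge directions lie on three lines, and every conformal rectangle R, P_G[crude crossing of R
at mesh δ] − P_ℤ²[crude crossing of R at mesh δ] → 0 as δ → 0⁺ (canonical weights; ℤ² =
bondPercolation (zdGraph 2) half via squareLatticeEmbedding). Via TransportSpecialisation it yields
CardyBondTriangular.TriangularToSquareTransport. [deps: GluingComparison, ExactRetiling]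
[difficulty: L] (why it might fail: Needs, per window, a second tiling by O(1) frozen 60°-blocks
WITHOUT lattice-width boundary collars, GM arm comparability and α₄>1 (van den Berg–Nolin) at
two-phase L(π/3)|L(π/3) seams/junctions, and d_CN-close ⇒ crossings agree; zigzag windows of a
general bi-periodic G may force collars.) [arXiv:2012.11672, arXiv:1204.0505, arXiv:1105.5535,
doi:10.2307/2324578, arXiv:2502.08394, arXiv:1404.2831]
#4 BondTriangularCardy (crux) — Anchor (verbatim the rank-3 crux of route CardyBondTriangular,
stmt-CriticalPhenomena-4664, so the two routes share it; card canonical-gluing-comparison via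
zero-error-star-triangle-gluing item (5), sharpened to the ℤ₃-symmetric bond lattice): canonical
bond percolation on 𝕋 (independent edges at criticalWeightI(π/6) = 2 sin(π/18)), embedded by z x =
√3(triEmbed x − (1+ζ)/3), satisfies Cardy's formula for every conformal rectangle in the crude
discretisation embDomainCrossing. [difficulty: open-problem] (why it might fail: As open as the
conjunct for a fixed bond lattice (Grimmett ICM 2014 §5(B)); bond-𝕋 is a ℤ₃-symmetric Chayes–Lei
cell model but their colour switching closes only for sparse irises ('beyond our present
capabilities', CL2007 p.5); no approximate switching with a summable defect is in print.)
[arXiv:math-ph/0601023, arXiv:0909.4499, arXiv:0708.3908, arXiv:1404.2831, Schramm2007ICM]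
#5 DiscretisationBridge (support since the retriage of 2026-08-15, rank 5 kept) — Discretisation
bridge on ℤ² (verbatim the item of routes CardyIsoradial / CardyBondTriangular,
stmt-CriticalPhenomena-0787): Cardy for the crude embedded crossing event (embDomainCrossing
squareLatticeEmbedding.z: open path with all vertices in Ω, endpoints within 2δ of the arcs) under
P_1/2 implies Cardy for G02's bondDomainCrossingProb (largest component Ω_δ, discrete arcs).
[difficulty: M] (why it might fail: Per-R over ALL Jordan R: the BR2006 sandwich needs convergence
in approximating domains, which the per-R hypothesis lacks; G02's largest-component rule equals the
bulk only for volume(∂Ω) = 0; boundary arm bounds at arbitrary ∂Ω (card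
discretisation-bridge-by-polygons, graded known).) [BollobasRiordan2006, arXiv:1101.5820,
doi:10.1007/s00440-006-0049-7, arXiv:0711.4948]
#9 ExactRetiling (support) — Exact retiling invariance (card zero-error-star-triangle-gluing M1),
RESTATED 2026-08-15 after refuters g41-41/g41-17/rreview-13a8c714 (the rev-0 `Convex ℝ K` window is
TRUE but unusable: ∂K must lie in the tile skeleton, and on the rhombille convex skeleton polygons
have diameter ≤ 6): two isoradial three-direction rhombic tilings on a common vertex type with equal
z (spare isolated vertices carry the other tiling's star centres), agreeing (edges and canonical
weights) on every rhombus not contained in the compact window K, no rhombus straddling ∂K, and whose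
OUTSIDE rhombi are corner-chain-connected (combinatorial 'K has no holes', replacing convexity: it
pins the two height functions together off K), give the same probability to every event of the
σ-algebra generated by the K-restricted connection events openConnIn {z ∈ K} a b with a, b off
interior K — crossings between such vertex sets and joint connection laws (RowLawIdentity) included.
Proof route: flip-connectivity of 3-direction tilings with pinned boundary heights (de Bruijn lift,
Thurston) + per-flip invariance by the tree's PROVED engine
prodBernoulli_eq_of_isStarTriangleRelated on an extended vertex type + 'invariant events form a
σ-algebra'. [difficulty: L] [arXiv:1105.5535, doi:10.2307/2324578, arXiv:1204.0505, Kenyon2002]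
#9 TransportOfGluing (support) — Glue of the foreseen split of WindowTransport3, RESTATED 2026-08-15
(cone repair): GluingComparison → IsoRectCrossingCoupling → IsoradialBoxCrossing → ExactRetiling →
WindowTransport3, the two middle antecedents inlined verbatim (Iff.rfl with the named form; inlined
only because the gate renders items in filing order) — i.e. the comparison principle, the DKKMO
crossing coupling for isoradial rectangular lattices, the Grimmett–Manolescu uniform box-crossing
property and exact retiling imply window transport (remaining internal work: track-cut cells / block
tilings of bi-periodic three-direction windows, a full-plane extension of the block tiling inside
𝒢(ε, I) so that IsoradialBoxCrossing applies uniformly in δ, arm comparability and α₄ > 1 at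
two-phase seams via GM 2013 §8 and van den Berg–Nolin, coupling-closeness ⇒ crossing agreement, and
the boundary-fuzz passage between Ω-restricted crude crossings and the K-restricted events of
ExactRetiling, SS App. A). [difficulty: L] [arXiv:2012.11672, arXiv:1204.0505, arXiv:1105.5535,
arXiv:2008.01606, arXiv:1101.5820]
#9 TriInstance3 (support) — Instance fact (extends CardyBondTriangular.TriIsoradialInstance,
stmt-CriticalPhenomena-4667, by two clauses; provable now modulo bookkeeping): triGraph is
preconnected and the rhombille embedding with z x = √3(triEmbed x − (1+ζ)/3) and faces HexVertex is
isoradial, a rhombic tiling, has the square-grid property and BAP(π/6), its rhombus-edge directions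
lie on three lines, the two lattice translations act as graph automorphisms shifting z by √3 and
√3ζ, and its canonical law is bondPercolation triGraph (criticalWeightI (π/6)). [difficulty: M]
[arXiv:1204.0505, Kenyon2002, arXiv:1105.5535]
#9 TransportSpecialisation (support) — Cross-route glue (provable now; term checked in the planner
sketch): WindowTransport3 → TriInstance3 → TriangularToSquareTransport, the rank-4 crux of route
CardyBondTriangular (stmt-CriticalPhenomena-4665) inlined verbatim as the conclusion — so closing
WindowTransport3 (with the instance fact) closes that XL crux: instantiate G = triGraph, rewrite z
and the canonical law, subtract limits. [difficulty: provable-now] [arXiv:2012.11672,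
arXiv:1204.0505]
#9 RowLawIdentity (support) — exact Z-invariance unit test of the infinite-wedge use of
ExactRetiling (joint row-connectivity law identical for critical bond-𝕋 and DKKMO's 𝕃(π/3) on the
common row); refuter Monte Carlo (g41-22, g41-17; kit j001075) agrees to 3·10⁻⁴ up to L = 512.
[difficulty: L] [arXiv:1105.5535, arXiv:2012.11672]
#9 TrackCutCells (support, informal — no signature until track / HasDirections vocabulary exists) —
cells without collars, cellwise exactness, seam-junction cones; paper-checked by refuters
g41-41/g41-17. [Kenyon2002, doi:10.2307/2324578]
#9 IsoRectCrossingCoupling (support; route repair 12:49Z) — the d_SS halves of DKKMO Thm 1.7 + Thm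
1.2 at q = 1 read as a crossing coupling of the rotated isoradial rectangular lattice w·𝕃(α) + c(δ)
with bond-ℤ²; the ONLY input from arXiv:2012.11672; replaces the d_CN named fact dkkmo_theorem_1_7
whose module dragged the loop/FK-Ising cone in. [difficulty: XL as a formalisation; known in print
modulo the coupling reading, grounder g13-40] [arXiv:2012.11672]
#9 IsoradialBoxCrossing (support; route repair by the rbadge planner seat) — verbatim body of the
Literature named fact gm_boxCrossingBounds_uniform (GM 2014 Thm 3.1 with (3.1): uniform BXP over
𝒢(ε, I), printed SGP(I)), carried as the route's OWN debt so that the cone is proved down to Mathlib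
(human rule 2026-08-15); Iff.rfl with the fact, so a Literature `_holds` witness closes it by
`exact` and conversely. [difficulty: XL as a formalisation; theorem in print] [arXiv:1204.0505]

TWO-LAYER PLAN. WindowTransport3 ⇐ TransportOfGluing-shaped split once GluingComparison closes: (a)
BlockTilingOfWindows (combinatorics: bi-periodic three-direction windows admit tilings by O(1)
frozen 60°-blocks, extendable to a full-plane isoradial square-lattice-type tiling with finitely
many sectors), (b) SectorwiseZ2 (each block family satisfies the hypotheses of GluingComparison
against ℤ²: RSW from IsoradialBoxCrossing (= GM14 Thm 3.1, applied to a full-plane extension of the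
block tiling chosen inside 𝒢(ε, I)), α₄ at seams from GM 2013 arm comparability for isoradial square
lattices + van den Berg–Nolin, coupling from IsoRectCrossingCoupling (= DKKMO Thm 1.7 + rotation,
crossing form)), (c) glue = ExactRetiling + boundary fuzz (SS App. A) — k = 3, depth 1.
GluingComparison ⇐ (i) NearMissOnSeam: uniformly in mesh, P[two disjoint macroscopic clusters both
meet an r-ball centred on the seam] → 0 (first-moment four-arm count), (ii) ChainRule: with (i), the
crossing indicator equals w.h.p. the indicator of a finite chain of macroscopic piece-clusters with
r-touching seam traces, (iii) glue. BondTriangularCardy is decomposed in route CardyBondTriangular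
(MesoscopicColourSwitching etc.), not here.

KILL CRITERIA. ¬WindowTransport3 (a bi-periodic three-direction G ∈ 𝒢 and a rectangle whose crossing
probabilities stay apart from ℤ²'s) refutes crossing universality itself — close
`refuted:WindowTransport3` (it also wounds CardyIsoradial and CardyBondTriangular).
¬GluingComparison by a counterexample INSIDE the hypotheses forces a pivot: restate with the extra
structure the block tilings actually have (BAP, square-grid property, exact agreement of the
piece-restrictions up to a coupling of d_CN type) — the route survives iff the witness is not of
block-tiling-vs-ℤ² type. BondTriangularCardy cannot be refuted without refuting universality for
bond-𝕋 (a major result either way; the route then re-anchors on any other bi-periodic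
three-direction G through WindowTransport3). DiscretisationBridge refuted ⇒ discretisation
mis-specified ⇒ operator, route blocked. CardyIsoradial.CrossingLimitInvariance proved, or [HM24]
published with q = 1 crossing consequences, moots WindowTransport3 (then this route = shared anchor
+ bridge and closes as superseded).

NOT DECOMPOSED YET. The block-tiling combinatorics and full-plane extension (which windows, how
collars are avoided); the passage d_CN-close ⇒ crossing indicators agree (Camia–Newman-type
no-touching estimates on L(α)); arm comparability at two-phase seams and at seam junctions; the r →
0 / d → 0 bookkeeping of the chain rule; site models and k ≥ 4 direction systems (zonotopal windows)
— all layer-2 children. Anchor technology (Chayes–Lei dense colour switching, mesoscopic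
Cauchy–Riemann) is deliberately NOT part of this route (route CardyBondTriangular owns it).

CHEAPEST FALSIFIER. Monte-Carlo, one afternoon (kit): (1) crossing probability of the unit square
straddling a straight seam between bond-ℤ² (below) and a 60°-rotated L(π/3) block or a
dislocated/shifted copy of ℤ² (above), meshes 1/64…1/512 — must converge to the pure-ℤ² value 1/2
within MC error (tests GluingComparison in its Use-2 'line defects are free' form; a persistent
offset kills the comparison principle); (2) bond-𝕋 vs bond-ℤ² crossing probabilities of 2:1
rectangles (LPSA-type numerics, arXiv:math/9401222 §3, already agree with Cardy to ~5e-3 — a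
disagreement at 1e-3 with modern sizes kills WindowTransport3). Lookup falsifier: if [HM24]
(Hansen–Manolescu, announced arXiv:2502.08394 Rem. 5.6) appears with q = 1 crossing statements,
WindowTransport3 becomes 'known' and the route's value contracts to GluingComparison. Not run here
(one-shot plancard seat; lit/galaxy daemons flaky this session).

NUMBERS. p_c(bond-𝕋) = 2 sin(π/18) = 0.347296…, p_c(bond-hex) = 1 − 2 sin(π/18) (in tree:
criticalWeight_pi_div_six, kappa_triangular); α₄(site-𝕋) = 5/4, α₄(ℤ²) ≥ 1 + α₂/2 > 1
(arXiv:2008.01606 Thm 1; Garban, arXiv:1101.5820 App. B); SS need only Δ₄ → 0; seam count for a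
coarse tiling with N lozenges ≤ 3N (fixed as δ → 0), versus ε⁻² boxes / seam mass ε^(−1/2) in the
box-wise schemes ruled out by card seam-pivotal-mass-no-go (route SeamPivotalNoGo); DKKMO rate C δ^c
(Thm 1.7). Items at open: 9 (4 cruxes — 2 of them shared —, 4 support, 1 assembly); after the
2026-08-15 repairs: 13 (4 cruxes, 8 support of which TrackCutCells informal, 1 assembly) + the
deciding theorem `closes : WindowTransport3 → TriInstance3 → BondTriangularCardy →
DiscretisationBridge → CardyFormulaZ2` (limit arithmetic, sorry-free); project cone 86 constants, 0
unproved Literature facts.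

DEFINITION REQUESTS. None needed for the signatures (three-direction and bi-periodicity clauses are
inlined; the alternating four-arm event is written with openConnIn as 'two disjoint open
annulus-clusters', the form of arXiv:2008.01606). Wishes recorded for the librarian, not filed:
RhombicEmbedding.HasDirections k / IsBiperiodic predicates; the Schramm–Smirnov quad-crossing space
ℋ_D with its topology (would let GluingComparison be stated as convergence of laws); named facts 'α₄
≥ 1 + α₂/2 on bond-ℤ²' (arXiv:2008.01606) and 'GM arm-event comparability across isoradial square
lattices' (arXiv:1204.0505 Props. 8.1–8.2) — filed as cite work items after open.

SUPPORT. Cone repair log (2026-08-15): the rev-0 file imported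
Literature.Probability.Percolation.LoopRepresentation for the named fact dkkmo_theorem_1_7 (14
loop-space / FK-Ising modules, 22 unproved facts in the import cone) and named
gm_boxCrossingBounds_uniform (cite-only) inside TransportOfGluing; both are now this route's own
support items (IsoRectCrossingCoupling, IsoradialBoxCrossing) inlined into TransportOfGluing, the
import list is CardyFormula + Isoradial only, and `#h21_route_deps` lists no unproved Literature
constant. Provable-now supports with candidate proofs on the ledger (grounder g13-40,
CRGAssembly.lean): TransportSpecialisation, Assembly; TriInstance3 is M bookkeeping (BAP(π/6) holds
because HasBoundedAngles is non-strict). ExactRetiling was restated (see RANKED CRUXES) rather than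
proved in its convex form.

Novelty: Searches (2026-08-15): `lit search --hybrid` ×2 ('gluing crossing quad configuration neighborhood
curve mesh percolation noise factorization', Chayes–Lei bond-triangular Cardy; local index: books
only, 10 rows each, nothing specific), `lit vsearch` ×1 (8 books), `lit citing arxiv:1101.5820` (83
citers; relevant: Khristoforov 2018 UNIGE thesis doi:10.13097/archive-ouverte/unige:111513, van den
Berg–Nolin arXiv:2008.01606, Book-percolation arXiv:2011.04644, Camia arXiv:2203.08167), `lit
frontier CriticalPhenomena --since 2020` (30 rows, none on ℤ² crossing universality or gluing), `lit
galaxy search … --star all` ×1 (pdf 0 hits; panama/crabby queued out), `lit search --source arxiv`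
(HTTP 429), page reads: arXiv:1101.5820 pp.7–9,11,17; arXiv:1204.0505 pp.7–8,23–25; Khristoforov
pp.29–37,45–47; arXiv:2008.01606 pp.1–3; tree files CardyFormula, Isoradial,
IsoradialRectangularLoops, LoopRepresentation, StarTriangle*, barrier catalogue; the routes
CardyIsoradial, CardyUniqueLimit, CardyBondTriangular; ledger negatives (1 SAW item); all 127 cards
of the sub via ledger idea list.
Nearest prior art found: arXiv:1101.5820 (Schramm–Smirnov 2011) Thm 1.1/1.7, Prop 4.1, Remark 3 and
QUESTION 2 (constructive gluing — 'would make the universality phenomenon more accessible');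
doi:10.13097/archive-ouverte/unige:111513 (Khristoforov 2018, Ch. II: lamination gluing Thms
II.2–II.3, non-constructive; Conj. II.1/III.1 = FIP); arXiv:1105.5535 + arXiv:1204.0505 (GM
star–triangle coupling, RSW/arms  [refs: 10.13097/archive-ouverte/unige:111513, 1101.5820, 2008.01606, 2011.04644, 2203.08167, 1204.0505, 1105.5535, 2012.11672, 2502.08394, arxiv:1101.5820, doi:10.13097/archive-ouverte/unige]

Barriers (technique_class: noise-factorisation seam comparison, star-triangle retiling): - technique_class: noise-factorisation seam comparison, star-triangle retiling
- Literature.Barriers.CriticalPhenomena.EmbeddingModulusUniqueness: evaded honestly — nothing here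
is embedding-blind: the block lattices are compared with ℤ² only in their ISORADIAL embedding (DKKMO
Thm 1.7 is false for sheared L(α)), the canonical weights are functions of the rhombus angles, and
all conformal content enters through the anchor; a sheared ℤ² would violate SectorwiseZ2, not the
logic.
- Literature.Barriers.CriticalPhenomena.SmirnovTriangularOnly: applies in full to
BondTriangularCardy and is the reason the anchor is moved INTO triangular geometry (bond-𝕋 =
ℤ₃-symmetric cell model on 𝕋, ψ ≡ 0 faces) rather than evaded; GluingComparison / WindowTransport3
use no observable and no colour switching.
- Literature.Barriers.CriticalPhenomena.CoveringLatticeShift: not met — bond-ℤ² is never rewritten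
as a site/mixed model and no shift/flip symmetry of ℤ² is used; the transport is by exact
star–triangle identities plus seam gluing (the barrier returns inside CardyBondTriangular's
colour-switching crux, i.e. on the anchor side only).
- Literature.Barriers.CriticalPhenomena.FKParafermionicHalfCauchyRiemann: not in the technique class
(no parafermionic observable); it would return only inside an observable-based attack on the anchor.
- Literature.Barriers.CriticalPhenomena.TransverseCrossingsNeedNotMeet: used, not evaded —
everything is planar (a horizontal and a vertical crossing of a box meet

History (route lifecycle, newest last):
- 2026-08-15T16:59:06Z · rev 2: restated ExactRetiling (stmt-CriticalPhenomena-7032), TransportOfGluing (stmt-CriticalPhenomena-7033) — route-repair(cone + refuter-requested restates): imports := [CardyFormula, Isoradial] (drop LoopRepresentation: no item uses it since the 12:53Z repair; it drag (planner-rbadge-CriticalPhenomena-CardyRetileGl-09abd673-g4-0)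
- 2026-08-26T12:04:10Z · DORMANT — reconciler: no traction for 8.3 d (last activity item-evidence-added at 2026-08-18T03:33:38Z); parked, not closed — `ledger route dormant route-CriticalPhenomen (operator:999:3832926)

sub-problem: CardyFormulaZ2 · status: dormant · opened planner-plancard-CriticalPhenomena-CardyFormu-067c29fc-0 2026-08-15T12:00:28Z · rev 2 · ledger route-CriticalPhenomena-CardyRetileGlue
GENERATED by the gate from the ledger (D-0016/17). Provers cite these decls: `theorem foo : Summit.CriticalPhenomena.CardyFormulaZ2.Theses.CardyRetileGlue.<Decl> := …` in Summits/CriticalPhenomena/CardyFormulaZ2/Theorems/<Name>.lean.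
-/

namespace Summit.CriticalPhenomena.CardyFormulaZ2.Theses.CardyRetileGlue

open scoped BigOperators Topology Manifold Classical MeasureTheory ProbabilityTheory Matrix InnerProductSpace ComplexConjugate ContinuousMap
open Filter Set Function TopologicalSpace MeasureTheory

attribute [summit_statement] _root_.CardyFormulaZ2

/-- item stmt-CriticalPhenomena-7030 · crux · rank 2 · open · by planner
why it might fail: Two-model form of Schramm–Smirnov's constructive gluing, OPEN (arXiv:1101.5820 Question 2; Rem. 3: their gluing map is non-constructive, may depend on mesh/model); the coupling sees only quads at positive distance from seams, so near-miss/multi-hop seam passages must be on-seam 4- /3-arm events.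
sources: arXiv:1101.5820, doi:10.13097/archive-ouverte/unige:111513, arXiv:1008.1378, arXiv:2008.01606, arXiv:1204.0505
[crux] Comparison principle (card canonical-gluing-comparison, Gluing Lemma; = Schramm–Smirnov
Question 2 in two-model form). Two mesh-indexed families of planar rhombic-tiling bond percolations
(canonical isoradial weights) with uniform box-crossing bounds and a uniform alternating four-arm
bound P[two disjoint open annulus-clusters cross A(w; mδ, nδ)] ≤ (m/n)·Δ(mδ, nδ), Δ(r, ρ) → 0 as r →
0 (SS Assumptions 1.1, four-arm event in the two-disjoint-clusters form of arXiv:2008.01606),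
coupled so that for every conformal rectangle whose closure avoids a fixed finite union of seam
segments the two crossing indicators agree with probability → 1, have asymptotically equal crossing
probabilities for EVERY conformal rectangle (in particular those straddling the seams). [difficulty:
L] -/
@[route_item "route-CriticalPhenomena-CardyRetileGlue"]
def GluingComparison : Prop :=
  ∀ (V F V' F' : Type) [Countable V] [DecidableEq V] [DecidableEq F] [Countable V'] [DecidableEq V'] [DecidableEq F'] (G : ℝ → SimpleGraph V) (G' : ℝ → SimpleGraph V') (emb : (δ : ℝ) → Literature.Probability.LatticeModels.RhombicEmbedding (G δ) F) (emb' : (δ : ℝ) → Literature.Probability.LatticeModels.RhombicEmbedding (G' δ) F') (S : Finset (ℂ × ℂ)), (∀ δ, (emb δ).IsIsoradial ∧ (emb δ).IsRhombicTiling ∧ (emb' δ).IsIsoradial ∧ (emb' δ).IsRhombicTiling) → (∃ c > (0 : ℝ), ∃ n₀ : ℕ, ∀ δ ∈ Set.Ioo (0 : ℝ) 1, Literature.Probability.LatticeModels.BoxCrossingBounds (emb δ).isoradialPercolation (emb δ).z 2 c n₀ ∧ Literature.Probability.LatticeModels.BoxCrossingBounds (emb' δ).isoradialPercolation (emb' δ).z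 2 c n₀) → (∃ R₀ > (0 : ℝ), ∃ Δ : ℝ → ℝ → ℝ, (∀ ρ ∈ Set.Ioo (0 : ℝ) R₀, Tendsto (fun r ↦ Δ r ρ) (𝓝[>] 0) (𝓝 0)) ∧ ∀ δ ∈ Set.Ioo (0 : ℝ) 1, ∀ (w : ℂ) (m n : ℕ), 1 ≤ m → m < n → (n : ℝ) * δ < R₀ → (emb δ).isoradialPercolation.real {ω | ∃ x₁ x₂ y₁ y₂ : V, ((emb δ).z x₁ - w).boxNorm ≤ m + 2 ∧ ((emb δ).z x₂ - w).boxNorm ≤ m + 2 ∧ (n : ℝ) ≤ ((emb δ).z y₁ - w).boxNorm ∧ (n : ℝ) ≤ ((emb δ).z y₂ - w).boxNorm ∧ ω ∈ Literature.Probability.Percolation.openConnIn {v | (m : ℝ) ≤ ((emb δ).z v - w).boxNorm ∧ ((emb δ).z v - w).boxNorm ≤ n + 2} x₁ y₁ ∧ ω ∈ Literature.Probability.Percolation.openConnIn {v | (m : ℝ) ≤ ((emb δ).z v - w).boxNorm ∧ ((emb δ).z v - w).boxNorm ≤ n + 2} x₂ y₂ ∧ ω ∉ Literature.Probability.Percolation.openConnIn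 {v | (m : ℝ) ≤ ((emb δ).z v - w).boxNorm ∧ ((emb δ).z v - w).boxNorm ≤ n + 2} x₁ x₂} ≤ (m / n : ℝ) * Δ (m * δ) (n * δ) ∧ (emb' δ).isoradialPercolation.real {ω | ∃ x₁ x₂ y₁ y₂ : V', ((emb' δ).z x₁ - w).boxNorm ≤ m + 2 ∧ ((emb' δ).z x₂ - w).boxNorm ≤ m + 2 ∧ (n : ℝ) ≤ ((emb' δ).z y₁ - w).boxNorm ∧ (n : ℝ) ≤ ((emb' δ).z y₂ - w).boxNorm ∧ ω ∈ Literature.Probability.Percolation.openConnIn {v | (m : ℝ) ≤ ((emb' δ).z v - w).boxNorm ∧ ((emb' δ).z v - w).boxNorm ≤ n + 2} x₁ y₁ ∧ ω ∈ Literature.Probability.Percolation.openConnIn {v | (m : ℝ) ≤ ((emb' δ).z v - w).boxNorm ∧ ((emb' δ).z v - w).boxNorm ≤ n + 2} x₂ y₂ ∧ ω ∉ Literature.Probability.Percolation.openConnIn {v | (m : ℝ) ≤ ((emb' δ).z v - w).boxNorm ∧ ((emb' δ).z v - w).boxNorm ≤ n + 2} x₁ x₂} ≤ (m / n : ℝ)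 * Δ (m * δ) (n * δ)) → (∃ P : ℝ → Measure (Literature.Probability.Percolation.BondConfig V × Literature.Probability.Percolation.BondConfig V'), (∀ δ, (P δ).map Prod.fst = (emb δ).isoradialPercolation ∧ (P δ).map Prod.snd = (emb' δ).isoradialPercolation) ∧ ∀ R : Literature.Probability.RandomPlanarGeometry.ConformalRectangle, closure R.carrier ⊆ (⋃ p ∈ S, segment ℝ p.1 p.2)ᶜ → Tendsto (fun δ ↦ (P δ).real {q | ¬ (q.1 ∈ Literature.Probability.Percolation.embDomainCrossing (emb δ).z R.carrier δ (R.arc 0) (R.arc 2) ↔ q.2 ∈ Literature.Probability.Percolation.embDomainCrossing (emb' δ).z R.carrier δ (R.arc 0) (R.arc 2))}) (𝓝[>] 0) (𝓝 0)) → ∀ R : Literature.Probability.RandomPlanarGeometry.ConformalRectangle, Tendsto (fun δ ↦ (emb δ).isoradialPercolation.real (Literature.Probability.Percolation.embDomainCrossing (emb δ).z R.carrier δ (R.arc 0) (R.arc 2)) - (emb' δ).isoradialPercolation.real (Literature.Probability.Percolation.embDomainCrossing (emb' δ).z R.carrier δ (R.arc 0) (R.arc 2))) (𝓝[>] 0)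 (𝓝 0)

/-- item stmt-CriticalPhenomena-7031 · crux · rank 3 · open · by planner
why it might fail: Crossing universality for bi-periodic isoradial bond percolation is OPEN (arXiv:1404.2831 §5(B); GM prove only RSW/arm universality); the announced proof [HM24] (arXiv:2502.08394 Rem. 5.6) is not on arXiv (checked 2026-08-15); the line also needs collar-free 60°-block retilings, α₄>1 at seams.
sources: arXiv:1404.2831, arXiv:1204.0505, arXiv:2012.11672, arXiv:2502.08394, arXiv:1105.5535, arXiv:2008.01606
[crux] Window transport (cards zero-error-star-triangle-gluing M1–M3 + canonical-gluing-comparison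
Use 1, window-retiling form): for every bi-periodic isoradial graph of the GM class (preconnected,
isoradial rhombic tiling, square-grid property, BAP(ε)) whose rhombus-edge directions lie on three
lines, and every conformal rectangle R, P_G[crude crossing of R at mesh δ] − P_ℤ²[crude crossing of
R at mesh δ] → 0 as δ → 0⁺ (canonical weights; ℤ² = bondPercolation (zdGraph 2) half via
squareLatticeEmbedding). Via TransportSpecialisation it yields
CardyBondTriangular.TriangularToSquareTransport. [deps: GluingComparison, ExactRetiling]
[difficulty: L] -/
@[route_item "route-CriticalPhenomena-CardyRetileGlue", crux]
def WindowTransport3 : Prop :=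
  ∀ (V F : Type) [Countable V] [DecidableEq V] [DecidableEq F] (G : SimpleGraph V) [G.LocallyFinite] (emb : Literature.Probability.LatticeModels.RhombicEmbedding G F), G.Preconnected → emb.IsIsoradial → emb.IsRhombicTiling → emb.HasSquareGridProperty → ∀ ε : ℝ, 0 < ε → emb.HasBoundedAngles ε → (∃ u : Fin 3 → ℂ, ∀ d : G.Dart, ∃ i : Fin 3, emb.c (emb.leftFace d) - emb.z d.fst = u i ∨ emb.c (emb.leftFace d) - emb.z d.fst = -(u i)) → (∃ (σ₁ σ₂ : G ≃g G) (t₁ t₂ : ℂ), t₁ ≠ 0 ∧ (t₂ / t₁).im ≠ 0 ∧ (∀ v, emb.z (σ₁ v) = emb.z v + t₁) ∧ ∀ v, emb.z (σ₂ v) = emb.z v + t₂) → ∀ R : Literature.Probability.RandomPlanarGeometry.ConformalRectangle, Tendsto (fun δ ↦ emb.isoradialPercolation.real (Literature.Probability.Percolation.embDomainCrossing emb.z R.carrier δ (R.arc 0) (R.arc 2)) - (Literature.Probability.Percolation.bondPercolation (Literature.Probability.LatticeModels.zdGraph 2) Literature.Probability.Percolation.half).real (Literature.Probability.Percolation.embDomainCrossing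 Literature.Probability.LatticeModels.squareLatticeEmbedding.z R.carrier δ (R.arc 0) (R.arc 2))) (𝓝[>] 0) (𝓝 0)

/-- item stmt-CriticalPhenomena-4664 · crux · rank 4 · open · by planner
why it might fail: Cardy for a fixed BOND lattice is as open as the conjunct (arXiv:1404.2831 §5(B); Schramm ICM 2006 Prob. 2.11): Smirnov's colour switching is site-𝕋 only (barrier SmirnovTriangularOnly); Chayes–Lei close it only for their iris models (arXiv:math-ph/0601023), not independent bond-𝕋 at 2sin(π/18).
sources: arXiv:math-ph/0601023, arXiv:0909.4499, arXiv:0708.3908, arXiv:1404.2831, Schramm2007ICM, Literature.Barriers.CriticalPhenomena.SmirnovTriangularOnly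
[crux] Cardy's formula for canonical bond percolation on 𝕋 (p = criticalWeightI(π/6) = 2 sin(π/18))
for every conformal rectangle, crude discretisation `embDomainCrossing`, embedding z x = √3(triEmbed
x − (1+ζ)/3) (card item 'Crux 1 BondTriangularCardy'). Other similarity copies of 𝕋 give formally
different (2δ slack, translated) events; this normalisation is the one both glue items below use.
Rank 3 because rank 2 is the informal mechanism crux MesoscopicColourSwitching (filed after open),
of which this is the parent. [difficulty: open-problem] -/
@[route_item "route-CriticalPhenomena-CardyRetileGlue", crux]
def BondTriangularCardy : Prop :=
  ∀ R : Literature.Probability.RandomPlanarGeometry.ConformalRectangle, R.HasCrossingLimit (fun δ ↦ (Literature.Probability.Percolation.bondPercolation Literature.Probability.LatticeModels.triGraph (Literature.Probability.LatticeModels.criticalWeightI (Real.pi / 6))).real (Literature.Probability.Percolation.embDomainCrossing (fun x : Literature.Probability.LatticeModels.Site 2 ↦ (Real.sqrt 3 : ℂ) * (Literature.Probability.LatticeModels.triEmbed x - (1 + Literature.Probability.LatticeModels.triZeta) / 3)) R.carrier δ (R.arc 0) (R.arc 2))) Literature.Probability.RandomPlanarGeometry.cardyFunction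

/-- item stmt-CriticalPhenomena-0787 · support · rank 5 · closed · proved by Summit.CriticalPhenomena.CardyFormulaZ2.Cruxes.DiscretisationBridge.Birth.DiscretisationBridge_skeleton @ b5325d8714b8 (prover) · by planner
why it might fail: Per-R over ALL Jordan R: the BR2006 sandwich needs convergence in approximating domains, which the per-R hypothesis lacks; G02's largest-component rule equals the bulk only for volume(∂Ω) = 0; boundary arm bounds at arbitrary ∂Ω (card discretisation-bridge-by-polygons, graded known).
sources: arXiv:1101.5820, arXiv:math/0604487, BollobasRiordan2006, Literature.Probability.RandomPlanarGeometry.JordanDomain.exists_forall_mem_meshDomain_and_reachable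
[crux] Discretisation bridge on Z^2: Cardy for the crude embedded crossing event (embDomainCrossing
squareLatticeEmbedding.z: open path with all vertices in Ω, endpoints within 2δ of the arcs (ab),
(cd)) under P_{1/2} implies Cardy for G02's bondDomainCrossingProb (largest component Ω_δ of Ω ∩
δZ^2, discrete arcs by distance comparison). Content: boundary RSW on Z^2 — crossings can be
re-routed near ∂Ω at o(1) cost; the Literature notes neither statement formally implies the other
(CardyFormula module doc, flag (i)). -/
@[route_item "route-CriticalPhenomena-CardyRetileGlue", crux]
def DiscretisationBridge : Prop :=
  ∀ R : Literature.Probability.RandomPlanarGeometry.ConformalRectangle, R.HasCrossingLimit (fun δ ↦ (Literature.Probability.Percolation.bondPercolation (Literature.Probability.LatticeModels.zdGraph 2) Literature.Probability.Percolation.half).real (Literature.Probability.Percolation.embDomainCrossing Literature.Probability.LatticeModels.squareLatticeEmbedding.z R.carrier δ (R.arc 0) (R.arc 2))) Literature.Probability.RandomPlanarGeometry.cardyFunction → R.HasCrossingLimit (Literature.Probability.Percolation.bondDomainCrossingProb R) Literature.Probability.RandomPlanarGeometry.cardyFunction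

/-- `DiscretisationBridge` holds: proved by `Summit.CriticalPhenomena.CardyFormulaZ2.Cruxes.DiscretisationBridge.Birth.DiscretisationBridge_skeleton` @ b5325d8714b8. -/
theorem DiscretisationBridge_holds : DiscretisationBridge := _root_.Summit.CriticalPhenomena.CardyFormulaZ2.Cruxes.DiscretisationBridge.Birth.DiscretisationBridge_skeleton

-- earlier ExactRetiling (stmt-CriticalPhenomena-7032, replaced 2026-08-15T16:59:06Z -> stmt-CriticalPhenomena-11312): retired by None — ∀ (V F₁ F₂ : Type) [Countable V] [DecidableEq V] [DecidableEq F₁] [DecidableEq F₂] (G₁ G₂ : SimpleGraph V) (emb₁ : Literature.Probability.LatticeModels.RhombicEmbedding G₁ F₁) (emb₂ : Literature.Probability.LatticeModels.RhombicEmbedding G₂ F₂) (K : Set ℂ), IsCompac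
/-- item stmt-CriticalPhenomena-11312 · support · rank 9 · open · by planner
sources: arXiv:1105.5535, doi:10.2307/2324578, arXiv:1204.0505
[support] EXACT RETILING (card zero-error-star-triangle-gluing M1), RESTATED 2026-08-15 after
refuters g41-41 / g41-17 / rreview-13a8c714 and grounder g13-40 (the rev-0 version with `Convex ℝ K`
is TRUE but unusable by its consumers: 'no rhombus straddles ∂K' puts ∂K in the tile skeleton, and
on the rhombille — the dice lattice, straight runs ≤ 2 — a convex skeleton polygon has diameter ≤ 6,
so neither bond-𝕋 windows nor the zigzag track-cut cells qualified). Statement: two isoradial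
three-direction rhombic tilings G₁, G₂ on a COMMON vertex type V with emb₁.z = emb₂.z (intended
trick, refuter-verified non-vacuous: IsIsoradial / IsRhombicTiling constrain darts only, so each
tiling's missing star centres ride along as ISOLATED vertices of the other graph), a compact window
K such that every rhombus of either tiling is contained in K or has interior disjoint from interior
K and is then a common edge with equal canonical weight, and such that the OUTSIDE rhombi (those not
contained in K) are chain-connected through rhombi sharing a point (combinatorial 'K has no holes';
replaces convexity — it is exactly what pins the two de Bruijn height functions together on and
outside ∂(⋃ inside rh -/
@[route_item "route-CriticalPhenomena-CardyRetileGlue"]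
def ExactRetiling : Prop :=
  ∀ (V F₁ F₂ : Type) [Countable V] [DecidableEq V] [DecidableEq F₁] [DecidableEq F₂] (G₁ G₂ : SimpleGraph V) (emb₁ : Literature.Probability.LatticeModels.RhombicEmbedding G₁ F₁) (emb₂ : Literature.Probability.LatticeModels.RhombicEmbedding G₂ F₂) (K : Set ℂ), IsCompact K → emb₁.z = emb₂.z → emb₁.IsIsoradial → emb₂.IsIsoradial → emb₁.IsRhombicTiling → emb₂.IsRhombicTiling → (∃ u : Fin 3 → ℂ, (∀ d : G₁.Dart, ∃ i : Fin 3, emb₁.c (emb₁.leftFace d) - emb₁.z d.fst = u i ∨ emb₁.c (emb₁.leftFace d) - emb₁.z d.fst = -(u i)) ∧ ∀ d : G₂.Dart, ∃ i : Fin 3, emb₂.c (emb₂.leftFace d) - emb₂.z d.fst = u i ∨ emb₂.c (emb₂.leftFace d) - emb₂.z d.fst = -(u i)) → (∀ e : G₁.edgeSet, emb₁.rhombus e ⊆ K ∨ (Disjoint (interior (emb₁.rhombus e)) (interior K) ∧ (e : Sym2 V) ∈ G₂.edgeSet ∧ emb₁.edgeWeight e = emb₂.edgeWeight e)) → (∀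 e : G₂.edgeSet, emb₂.rhombus e ⊆ K ∨ (Disjoint (interior (emb₂.rhombus e)) (interior K) ∧ (e : Sym2 V) ∈ G₁.edgeSet ∧ emb₂.edgeWeight e = emb₁.edgeWeight e)) → (∀ e e' : G₁.edgeSet, ¬ emb₁.rhombus e ⊆ K → ¬ emb₁.rhombus e' ⊆ K → Relation.ReflTransGen (fun a b : G₁.edgeSet ↦ ¬ emb₁.rhombus a ⊆ K ∧ ¬ emb₁.rhombus b ⊆ K ∧ (emb₁.rhombus a ∩ emb₁.rhombus b).Nonempty) e e') → ∀ E : Set (Literature.Probability.Percolation.BondConfig V), MeasurableSet[MeasurableSpace.generateFrom {A | ∃ a b : V, emb₁.z a ∉ interior K ∧ emb₁.z b ∉ interior K ∧ A = Literature.Probability.Percolation.openConnIn {v | emb₁.z v ∈ K} a b}] E → emb₁.isoradialPercolation E = emb₂.isoradialPercolation E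

-- earlier TransportOfGluing (stmt-CriticalPhenomena-7033, replaced 2026-08-15T16:59:06Z -> stmt-CriticalPhenomena-11313): retired by None — GluingComparison → (∀ α ∈ Set.Ioo (0 : ℝ) Real.pi, ∀ (w : ℂ), ‖w‖ = 1 → ∀ c : ℝ → ℂ, ∃ P : ℝ → Measure (Literature.Probability.Percolation.BondConfig (Literature.Probability.LatticeModels.Site 2) × Literature.Probability.Percolation.BondConfig (Literature.Probab
/-- item stmt-CriticalPhenomena-11313 · support · rank 9 · open · by planner
sources: arXiv:2012.11672, arXiv:1204.0505, arXiv:1105.5535, arXiv:2008.01606, arXiv:1101.5820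
[support] Glue of the foreseen split of WindowTransport3, RESTATED 2026-08-15 (route repair;
refuters g41-41/g41-17 'repoint to 8437'): GluingComparison → IsoRectCrossingCoupling →
IsoradialBoxCrossing → ExactRetiling → WindowTransport3 with the two middle antecedents INLINED
verbatim (the equivalence with the named form is Iff.rfl, planner Sketch2.lean rc0; inlined only
because the gate renders items in filing order, so a by-name reference to a later-filed item would
not elaborate). Content: the comparison principle, the DKKMO crossing coupling for rotated isoradial
rectangular lattices (arXiv:2012.11672 Thm 1.7 + Thm 1.2 at q = 1, item IsoRectCrossingCoupling),
the Grimmett–Manolescu uniform box-crossing property (arXiv:1204.0505 Thm 3.1, item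
IsoradialBoxCrossing) and exact retiling imply window transport. Remaining internal work (L):
track-cut cells / block tilings of bi-periodic three-direction windows without collars
(TrackCutCells); a full-plane extension of the block tiling chosen INSIDE 𝒢(ε, I) so that
IsoradialBoxCrossing applies with one (c, n₀) for all δ (WindowTransport3 itself only assumes the
H21 rendering HasSquareGridProperty of G, but after exact retiling RSW is n -/
@[route_item "route-CriticalPhenomena-CardyRetileGlue"]
def TransportOfGluing : Prop :=
  GluingComparison → (∀ α ∈ Set.Ioo (0 : ℝ) Real.pi, ∀ (w : ℂ), ‖w‖ = 1 → ∀ c : ℝ → ℂ, ∃ P : ℝ → Measure (Literature.Probability.Percolation.BondConfig (Literature.Probability.LatticeModels.Site 2) × Literature.Probability.Percolation.BondConfig (Literature.Probability.LatticeModels.Site 2)), (∀ δ, (P δ).map Prod.fst = Literature.Probability.LatticeModels.prodBernoulli (fun e : Sym2 (Literature.Probability.LatticeModels.Site 2) ↦ if e ∈ (Literature.Probability.LatticeModels.zdGraph 2).edgeSet then (if (∃ x y : Literature.Probability.LatticeModels.Site 2, e = s(x, y) ∧ x 1 = y 1) then Literature.Probability.LatticeModels.criticalWeightI (α / 2) else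 Literature.Probability.LatticeModels.criticalWeightI ((Real.pi - α) / 2)) else 0) ∧ (P δ).map Prod.snd = Literature.Probability.Percolation.bondPercolation (Literature.Probability.LatticeModels.zdGraph 2) Literature.Probability.Percolation.half) ∧ ∀ R : Literature.Probability.RandomPlanarGeometry.ConformalRectangle, Tendsto (fun δ ↦ (P δ).real {q | ¬ (q.1 ∈ Literature.Probability.Percolation.embDomainCrossing (fun x : Literature.Probability.LatticeModels.Site 2 ↦ w * ((2 * Real.cos (α / 2) : ℝ) * ((x 0 : ℤ) : ℂ) + (2 * Real.sin (α / 2) : ℝ) * ((x 1 : ℤ) : ℂ) * Complex.I) + c δ) R.carrier δ (R.arc 0) (R.arc 2) ↔ q.2 ∈ Literature.Probability.Percolation.embDomainCrossing Literature.Probability.LatticeModels.squareLatticeEmbedding.z R.carrier δ (R.arc 0) (R.arc 2))}) (𝓝[>] 0) (𝓝 0)) → (∀ (ε : ℝ) (hε : 0 < ε) (I : ℕ) (ρ : ℝ) (hρ : 0 < ρ), ∃ c > (0 : ℝ), ∃ n₀ : ℕ, ∀ (V F : Type) [Countable V] [DecidableEq V] [DecidableEq F] (G : SimpleGraph V) [G.LocallyFinite]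 (emb : Literature.Probability.LatticeModels.RhombicEmbedding G F), G.Preconnected → emb.IsIsoradial → emb.IsRhombicTiling → emb.HasBoundedAngles ε → emb.SquareGridPropertyGM I → Literature.Probability.LatticeModels.BoxCrossingBounds emb.isoradialPercolation emb.z ρ c n₀) → ExactRetiling → WindowTransport3

/-- item stmt-CriticalPhenomena-11314 · support · rank 9 · open · by planner
sources: arXiv:1204.0505, GrimmettManolescu2014Isoradial
[support] UNIFORM BOX-CROSSING PROPERTY for the Grimmett–Manolescu class 𝒢(ε, I) — verbatim the body
of the Literature named fact `Literature.Probability.Percolation.gm_boxCrossingBounds_uniform`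
(Grimmett–Manolescu, PTRF 159 (2014) 273–327 = arXiv:1204.0505, §3 Thm 3.1 with display (3.1): for ε
> 0, I ∈ ℕ and aspect ratio ρ > 0 there are c > 0, n₀ depending only on (ε, I, ρ) such that the
canonical measure of every preconnected isoradial rhombic tiling with BAP(ε) and the printed
square-grid property SGP(I) satisfies BoxCrossingBounds ρ c n₀), carried as this route's OWN debt
(route repair 2026-08-15; human rule: a thesis is staffed only when its dependency cone is proved
down to Mathlib, its own items excepted — the cite-only fact was the route's last unproved cone
dependency, entering through TransportOfGluing). `IsoradialBoxCrossing ↔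
gm_boxCrossingBounds_uniform` is `Iff.rfl` (planner Sketch2.lean rc0), so a Literature `_holds`
witness closes this item by `exact` and a proof landed here should be mirrored into Literature.
Theorem in print (≈ 50 pp. of star–triangle transport of open box crossings; the ℤ² base case is
PROVED in tree, IsoradialBoxCrossingGM.gm_boxCrossing_square -/
@[route_item "route-CriticalPhenomena-CardyRetileGlue"]
def IsoradialBoxCrossing : Prop :=
  ∀ (ε : ℝ) (hε : 0 < ε) (I : ℕ) (ρ : ℝ) (hρ : 0 < ρ), ∃ c > (0 : ℝ), ∃ n₀ : ℕ, ∀ (V F : Type) [Countable V] [DecidableEq V] [DecidableEq F] (G : SimpleGraph V) [G.LocallyFinite] (emb : Literature.Probability.LatticeModels.RhombicEmbedding G F), G.Preconnected → emb.IsIsoradial → emb.IsRhombicTiling → emb.HasBoundedAngles ε → emb.SquareGridPropertyGM I → Literature.Probability.LatticeModels.BoxCrossingBounds emb.isoradialPercolation emb.z ρ c n₀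

/-- item stmt-CriticalPhenomena-7034 · support · rank 9 · open · by planner
sources: arXiv:1204.0505, Kenyon2002, arXiv:1105.5535
[support] Instance fact (extends CardyBondTriangular.TriIsoradialInstance,
stmt-CriticalPhenomena-4667, by two clauses; provable now modulo bookkeeping): triGraph is
preconnected and the rhombille embedding with z x = √3(triEmbed x − (1+ζ)/3) and faces HexVertex is
isoradial, a rhombic tiling, has the square-grid property and BAP(π/6), its rhombus-edge directions
lie on three lines, the two lattice translations act as graph automorphisms shifting z by √3 and
√3ζ, and its canonical law is bondPercolation triGraph (criticalWeightI (π/6)). [difficulty: M] -/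
@[route_item "route-CriticalPhenomena-CardyRetileGlue", crux]
def TriInstance3 : Prop :=
  Literature.Probability.LatticeModels.triGraph.Preconnected ∧ ∃ emb : Literature.Probability.LatticeModels.RhombicEmbedding Literature.Probability.LatticeModels.triGraph Literature.Probability.LatticeModels.HexVertex, emb.z = (fun x : Literature.Probability.LatticeModels.Site 2 ↦ (Real.sqrt 3 : ℂ) * (Literature.Probability.LatticeModels.triEmbed x - (1 + Literature.Probability.LatticeModels.triZeta) / 3)) ∧ emb.IsIsoradial ∧ emb.IsRhombicTiling ∧ emb.HasSquareGridProperty ∧ emb.HasBoundedAngles (Real.pi / 6) ∧ (∃ u : Fin 3 → ℂ, ∀ d : Literature.Probability.LatticeModels.triGraph.Dart, ∃ i : Fin 3, emb.c (emb.leftFace d) - emb.z d.fst = u i ∨ emb.c (emb.leftFace d) - emb.z d.fst = -(u i)) ∧ (∃ (σ₁ σ₂ : Literature.Probability.LatticeModels.triGraph ≃g Literature.Probability.LatticeModels.triGraph) (t₁ t₂ : ℂ), t₁ ≠ 0 ∧ (t₂ / t₁).im ≠ 0 ∧ (∀ v, emb.z (σ₁ v) = emb.z v + t₁) ∧ ∀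 v, emb.z (σ₂ v) = emb.z v + t₂) ∧ emb.isoradialPercolation = (Literature.Probability.Percolation.bondPercolation Literature.Probability.LatticeModels.triGraph (Literature.Probability.LatticeModels.criticalWeightI (Real.pi / 6)))

/-- item stmt-CriticalPhenomena-7035 · support · rank 9 · open · by planner
sources: arXiv:2012.11672, arXiv:1204.0505
[support] Cross-route glue (provable now; term checked in the planner sketch): WindowTransport3 →
TriInstance3 → TriangularToSquareTransport, the rank-4 crux of route CardyBondTriangular
(stmt-CriticalPhenomena-4665) inlined verbatim as the conclusion — so closing WindowTransport3 (with
the instance fact) closes that XL crux: instantiate G = triGraph, rewrite z and the canonical law,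
subtract limits. [difficulty: provable-now] -/
@[route_item "route-CriticalPhenomena-CardyRetileGlue"]
def TransportSpecialisation : Prop :=
  WindowTransport3 → TriInstance3 → ∀ Φ : ℝ → ℝ, (∀ R : Literature.Probability.RandomPlanarGeometry.ConformalRectangle, R.HasCrossingLimit (fun δ ↦ (Literature.Probability.Percolation.bondPercolation Literature.Probability.LatticeModels.triGraph (Literature.Probability.LatticeModels.criticalWeightI (Real.pi / 6))).real (Literature.Probability.Percolation.embDomainCrossing (fun x : Literature.Probability.LatticeModels.Site 2 ↦ (Real.sqrt 3 : ℂ) * (Literature.Probability.LatticeModels.triEmbed x - (1 + Literature.Probability.LatticeModels.triZeta) / 3)) R.carrier δ (R.arc 0) (R.arc 2))) Φ) → ∀ R : Literature.Probability.RandomPlanarGeometry.ConformalRectangle, R.HasCrossingLimit (fun δ ↦ (Literature.Probability.Percolation.bondPercolation (Literature.Probability.LatticeModels.zdGraph 2) Literature.Probability.Percolation.half).real (Literature.Probability.Percolation.embDomainCrossing Literature.Probability.LatticeModels.squareLatticeEmbedding.z R.carrier δ (R.arc 0) (R.arc 2))) Φ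

/-- item stmt-CriticalPhenomena-7656 · support · rank 9 · open · by planner
[support] ROW-LAW IDENTITY (from the plancard seat of card zero-error-star-triangle-gluing; exact,
checkable, unit test of the infinite-wedge form of ExactRetiling used at seam junctions — see
support TrackCutCells (d),(e)): the joint connectivity law of the lattice row {(n,0) : n ∈ ℤ} is
IDENTICAL for critical bond percolation on the triangular lattice triGraph (independent edges, p =
criticalWeightI(π/6) = 2 sin(π/18) = 0.347296…) and for DKKMO's critical rectangular lattice 𝕃(π/3)
= isoRectPercolation (π/3) on the same vertex set (horizontal edges p = criticalWeightI(π/6), the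
same value, vertical edges p = criticalWeightI(π/3) = 1 − 2 sin(π/18)); stated as equality of P[∀ i,
(a_i,0) ↔ (b_i,0)] for every finite family of pairs, which determines the partition law by
inclusion–exclusion. In particular P_𝕋(0 ↔ e₀) = P_𝕃(0 ↔ e₀) and P_𝕋(0 ↔ 2e₀) = P_𝕃(0 ↔ 2e₀)
exactly. PROOF ROUTE (no new idea): the row is a zigzag track-boundary of the rhombille; the big
rhombus P_R with the row segment [−R, R] as diagonal splits into two triangles U_R, D_R (unions of
rhombille tiles); ExactRetiling/M1 on each triangle equates the boundary-partition laws of the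
rhombille tiling and of the cube-corn -/
@[route_item "route-CriticalPhenomena-CardyRetileGlue"]
def RowLawIdentity : Prop :=
  ∀ (n : ℕ) (a b : Fin n → ℤ), (Literature.Probability.Percolation.bondPercolation Literature.Probability.LatticeModels.triGraph (Literature.Probability.LatticeModels.criticalWeightI (Real.pi / 6))).real {ω | ∀ i, (Literature.Probability.Percolation.openGraph ω).Reachable ![a i, 0] ![b i, 0]} = (Literature.Probability.LatticeModels.prodBernoulli (fun e : Sym2 (Literature.Probability.LatticeModels.Site 2) ↦ if e ∈ (Literature.Probability.LatticeModels.zdGraph 2).edgeSet then (if (∃ x y : Literature.Probability.LatticeModels.Site 2, e = s(x, y) ∧ x 1 = y 1) then Literature.Probability.LatticeModels.criticalWeightI (Real.pi / 6) else Literature.Probability.LatticeModels.criticalWeightI (Real.pi / 3)) else 0)).real {ω | ∀ i, (Literature.Probability.Percolation.openGraph ω).Reachable ![a i, 0] ![b i, 0]}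

-- item stmt-CriticalPhenomena-7657 · support · rank 9 · open · by planner — informal only, no Lean statement yet:
--   [support] TRACK-CUT CELLS (from the plancard seat of card zero-error-star-triangle-gluing; answers
--   two recorded sub-points of WindowTransport3: 'zigzag windows may force collars', 'arm comparability
--   at seam junctions'). Let T be a three-direction rhombic tiling of the plane in 𝒢(ε, I) (side
--   directions ±u₀, ±u₁, ±u₂). (a) CELLS WITHOUT COLLARS: both boundary paths of every train track are
--   2-letter staircases (a u_i-track is bounded by paths using only ±u_j, ±u_k), i.e. exactly the
--   boundary type of a single-type {j,k}-grid block; cutting the plane along every ⌊L/δ⌋-th track of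
--   each of the three

/-- item stmt-CriticalPhenomena-8437 · support · rank 9 · open · by planner
[support] DKKMO CROSSING COUPLING for isoradial rectangular lattices — the ONLY input from
arXiv:2012.11672 this line uses, stated in the sub-problem statement's own vocabulary (route repair
2026-08-15: it replaces the d_CN named fact `dkkmo_theorem_1_7` of `LoopRepresentation`, whose
module dragged 14 loop-space / FK-Ising modules and 6 unproved XL facts into the route's import
cone). Content = the SCHRAMM–SMIRNOV (d_SS) halves of DKKMO's universality theorem for rectangular
lattices (Thm 2.1 of arXiv:2012.11672v1 = Thm 1.7 of v2) and of rotation invariance (Thm 1.2 / Cor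
1.3), at q = 1, read on crossing indicators: for every α ∈ (0, π), every rotation w (‖w‖ = 1) and
every mesh-dependent offset c(δ), bond percolation on the abstract ℤ² with DKKMO's inhomogeneous
critical weights — horizontal edges criticalWeightI(α/2), vertical edges criticalWeightI((π − α)/2),
the canonical isoradial weights of 𝕃(α); this is literally the tree's `isoRectPercolation α`
unfolded to `prodBernoulli` (kernel-checked by `unfold; congr; …` in the repair sketch) — drawn at
mesh δ as the rotated rectangular lattice δ(w·𝕃(α)) + δ c(δ) (vertex x ↦ w(2cos(α/2) x₀ + 2 sin(α/2)
x₁ i) + c δ, i.e. w e^{−iα/2}·i -/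
@[route_item "route-CriticalPhenomena-CardyRetileGlue"]
def IsoRectCrossingCoupling : Prop :=
  ∀ α ∈ Set.Ioo (0 : ℝ) Real.pi, ∀ (w : ℂ), ‖w‖ = 1 → ∀ c : ℝ → ℂ, ∃ P : ℝ → Measure (Literature.Probability.Percolation.BondConfig (Literature.Probability.LatticeModels.Site 2) × Literature.Probability.Percolation.BondConfig (Literature.Probability.LatticeModels.Site 2)), (∀ δ, (P δ).map Prod.fst = Literature.Probability.LatticeModels.prodBernoulli (fun e : Sym2 (Literature.Probability.LatticeModels.Site 2) ↦ if e ∈ (Literature.Probability.LatticeModels.zdGraph 2).edgeSet then (if (∃ x y : Literature.Probability.LatticeModels.Site 2, e = s(x, y) ∧ x 1 = y 1) then Literature.Probability.LatticeModels.criticalWeightI (α / 2) else Literature.Probability.LatticeModels.criticalWeightI ((Real.pi - α) / 2)) else 0) ∧ (P δ).map Prod.snd = Literature.Probability.Percolation.bondPercolation (Literature.Probability.LatticeModels.zdGraph 2) Literature.Probability.Percolation.half) ∧ ∀ R : Literature.Probability.RandomPlanarGeometry.ConformalRectangle, Tendsto (fun δ ↦ (P δ).real {q | ¬ (q.1 ∈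 Literature.Probability.Percolation.embDomainCrossing (fun x : Literature.Probability.LatticeModels.Site 2 ↦ w * ((2 * Real.cos (α / 2) : ℝ) * ((x 0 : ℤ) : ℂ) + (2 * Real.sin (α / 2) : ℝ) * ((x 1 : ℤ) : ℂ) * Complex.I) + c δ) R.carrier δ (R.arc 0) (R.arc 2) ↔ q.2 ∈ Literature.Probability.Percolation.embDomainCrossing Literature.Probability.LatticeModels.squareLatticeEmbedding.z R.carrier δ (R.arc 0) (R.arc 2))}) (𝓝[>] 0) (𝓝 0)

/-- item stmt-CriticalPhenomena-7036 · assembly · rank 1 · open · by planner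
sources: arXiv:1101.5820, arXiv:2012.11672
[assembly] WindowTransport3 → TriInstance3 → BondTriangularCardy → DiscretisationBridge →
CardyFormulaZ2. -/
@[route_item "route-CriticalPhenomena-CardyRetileGlue"]
def Assembly : Prop :=
  WindowTransport3 → TriInstance3 → BondTriangularCardy → DiscretisationBridge → CardyFormulaZ2

/-! D-0027 §2.1 — DECIDING THEOREM (planner-authored via `route open/edit --closes-file`; by planner-rbadge-CriticalPhenomena-CardyRetileGl-09abd673-g4-0 2026-08-15T16:57:31Z):
its hypotheses are this route's items and its conclusion the sub-problem Statement (glue_lint), and it elaborates with this file. -/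

@[closes "route-CriticalPhenomena-CardyRetileGlue"] theorem closes (hW : WindowTransport3) (hT : TriInstance3) (hB : BondTriangularCardy)
    (hD : DiscretisationBridge) : _root_.CardyFormulaZ2 := by
  intro R
  refine hD R ?_
  intro φ x hφx
  obtain ⟨hpre, emb, hz, hiso, htile, hsgp, hbap, hdir, hper, hlaw⟩ := hT
  have h1 := hW _ _ Literature.Probability.LatticeModels.triGraph emb hpre hiso htile hsgp
    (Real.pi / 6) (by positivity) hbap hdir hper R
  have h2 := hB R φ x hφx
  rw [hlaw, hz] at h1
  have h3 := h2.sub h1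
  simp only [sub_sub_cancel, sub_zero] at h3
  exact h3

end Summit.CriticalPhenomena.CardyFormulaZ2.Theses.CardyRetileGlue
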